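import Literature.NumberTheory.Automorphic.UnitaryGroupFormTransport
import Literature.MeasureTheory.Constructions.MvPolynomialZeroSetNull
import Literature.LinearAlgebra.Matrix.CubicDiscriminantDiagonalScaling
import Mathlib.MeasureTheory.Measure.Haar.Basic
import Mathlib.Topology.Algebra.MvPolynomial
import HarnessLib

/-!
# The singular set of a unitary group in three variables over a local field is Haar-null

Topic `LinearAlgebra/Matrix`; namespace `Literature.LinearAlgebra.Matrix`.  THEOREMS ONLY (no definition, no instance, no notation, no named fact,
no `sorry`), over ★ `UnitaryGroupFormTransport` (`unitaryGroupOfForm σ J`, `formCongr`, `unitaryGroupOfFormCongrOfEq`), ★ `MvPolynomialZeroSetNull`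
(Fubini null-set criteria) and ★ `CubicDiscriminantDiagonalScaling` (the rank-`3` discriminant algebra).  Companion of ★ `UnitaryCentralizerSingularLocus`
(the singular locus of ONE Cartan subgroup): here the singular locus of the WHOLE group.

SETTING.  `K` a non-discrete locally compact second-countable Hausdorff topological field of characteristic `0` with its Borel σ-algebra (a local
field of characteristic `0`), `σ : K →+* K` a continuous involution moving some element (`σ a ≠ a`), `ε_k → 0` non-zero `σ`-fixed scalars (for the
conjugation of a quadratic extension of local fields: `a` any non-fixed element, `ε_k = ϖ^k` with `ϖ` a fixed uniformiser), and `J ∈ M₃(K)` congruent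
over `K` to a diagonal matrix: `ᵗσ(T)·J·T = diag(h)` for some `T ∈ GL₃(K)` (no invertibility of `J` needed).

RESULT **`measure_setOf_not_separable_charpoly_eq_zero`**: for every Haar measure `ν` on `U(σ, J) = {g ∈ GL₃(K) | ᵗσ(g) J g = J}`, the set of
`u ∈ U(σ, J)` whose characteristic polynomial is NOT separable (the non-regular-semisimple elements) is `ν`-null.  [HarishChandra1970, Lemma 42] /
[Rogawski1990, §12.5 p. 182] («the set of regular elements … its complement has measure zero», the tacit measure theory behind the Weyl integration
formula `∫_G f = Σ_T |W_T|⁻¹ ∫_T D² Φ(γ, f)`).  Stronger packaging **`exists_closed_null_superset_singular`**: a CLOSED set containing the singular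
locus and null for EVERY Haar measure (so the statement transports along isomorphisms of topological groups without measurability questions about
«separable»).

PROOF (chart-free; no `p`-adic manifold theory).
* §1 THE PARAMETER TORUS.  The push-forward `μ₁` of additive Haar measure (restricted to a compact neighbourhood) under `x ↦ x∕σ(x)` is a finite
  non-zero ATOMLESS measure carried by the norm-one torus `U(1) = {u | u·σ(u) = 1}`: the fibre over `u` lies in the closed additive subgroup
  `{x | x = u·σ(x)}`, which is NOT open (`ε_k y → 0` would force `y = u σ(y)` for all `y`, i.e. `u = 1` and `σ = id`), hence Haar-null by Steinhaus
  (Mathlib `sub_mem_nhds_zero_of_addHaar_pos`) — `addHaar_setOf_eq_mul_map_eq_zero`, `exists_atomless_measure_normOneTorus`.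
* §2 DIAGONAL FORMS `J = diag(h)`.  `u ∈ U(1)³ ↦ ι(u) = diag(u) ∈ U(σ, diag h)` is continuous; by ★ `exists_mvPolynomial_discr_charpoly_fin_three` there is
  a polynomial `D` in the entries with `D ≠ 0 ⇒` separable, so `S′ = {D = 0}` is a CLOSED superset of the singular locus; for EVERY `g` the fibre
  `{u | ι(u)·g ∈ S′}` lies in `(U(1)³)ᶜ ∪ {u ∈ K³ | D(diag(u)·g) = 0}`, null for `μ₁^{⊗3}` because `u ↦ D(diag(u)·g)` is a NON-ZERO polynomial (★ (b)) and
  zero sets of non-zero polynomials are null for products of atomless measures (★ `pi_zeroLocus_mvPolynomial_eq_zero`); the shear criterion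
  (★ `measure_eq_zero_of_forall_shear_null`) gives `ν S′ = 0`.
* §3 GENERAL `J`: transport along `U(σ, diag h) ≃ₜ* U(σ, J)`, `g ↦ T g T⁻¹` (★ `unitaryGroupOfFormCongrOfEq`), which preserves characteristic
  polynomials (Mathlib `Matrix.charpoly_units_conj`) and Haar measures (Mathlib `ContinuousMulEquiv.isHaarMeasure_map`).
Consumer: the `hodgecm-mathlib` cell, crux H413, line LH6 «StCharTS», brick (J8) «SINGULAR-NULL-G» for `U(Φ₃)(L⁺_v)` (FULL Weyl integration formula).

## References
* [HarishChandra1970] Harish-Chandra (notes by G. van Dijk), *Harmonic Analysis on Reductive p-adic Groups*, LNM 162 (1970), Lemma 42.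
* [Rogawski1990] J. D. Rogawski, *Automorphic Representations of Unitary Groups in Three Variables*, Ann. of Math. Stud. 123 (1990), §12.5 p. 182.
* [Folland1995] G. B. Folland, *A Course in Abstract Harmonic Analysis* (1995), Prop. 2.4 (Steinhaus), §2.2.
-/

set_option autoImplicit false

noncomputable section

open _root_.MeasureTheory _root_.MeasureTheory.Measure _root_.Topology Filter Set Function
open Literature.NumberTheory.Automorphic Literature.MeasureTheory.Constructions
open scoped Matrix MatrixGroups

namespace Literature.LinearAlgebra.Matrix

/-! ## §1 The parameter torus: an atomless measure on `U(1) = {u | u σ(u) = 1}` -/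

section Torus

variable {K : Type*} [Field K] [TopologicalSpace K] [IsTopologicalRing K] [ContinuousInv₀ K] [T2Space K]
  [LocallyCompactSpace K] [SecondCountableTopology K] [MeasurableSpace K] [BorelSpace K]
  (σ : K →+* K) (hσc : Continuous σ)

omit [ContinuousInv₀ K] in
include hσc in
/-- **The twisted fixed lines `{x | x = u·σ(x)}` are Haar-null.**  For a continuous ring endomorphism `σ` of the locally compact second-countable field
`K` moving some `a` and fixing a null sequence of non-zero scalars `ε_k`, and any `u ∈ K`: the closed additive subgroup `{x | x = u σ x}` is not open (if it
were a neighbourhood of `0`, then `ε_k y` would lie in it for large `k`, forcing `y = u σ y` for every `y`, so `u = 1` and `σ = id`), hence null for every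
additive Haar measure `μ` (Steinhaus: a measurable subgroup of positive measure is a neighbourhood of `0`). [cite: Folland1995, Prop. 2.4] -/
theorem addHaar_setOf_eq_mul_map_eq_zero (μ : Measure K) [μ.IsAddHaarMeasure] {a : K} (ha : σ a ≠ a)
    {ε : ℕ → K} (hε : Tendsto ε atTop (𝓝 0)) (hε0 : ∀ k, ε k ≠ 0) (hσε : ∀ k, σ (ε k) = ε k) (u : K) :
    μ {x : K | x = u * σ x} = 0 := by
  let A : AddSubgroup K :=
    { carrier := {x | x = u * σ x}
      zero_mem' := by simp
      add_mem' := fun {x y} hx hy => by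
        simp only [mem_setOf_eq] at hx hy ⊢
        rw [map_add, mul_add, ← hx, ← hy]
      neg_mem' := fun {x} hx => by
        simp only [mem_setOf_eq] at hx ⊢
        rw [map_neg, mul_neg, ← hx] }
  have hAset : (A : Set K) = {x | x = u * σ x} := rfl
  have hAcl : IsClosed (A : Set K) := by
    rw [hAset]
    exact isClosed_eq continuous_id (continuous_const.mul hσc)
  rw [← hAset]
  by_contra hne
  have hpos : 0 < μ A := pos_iff_ne_zero.mpr hne
  haveI : SigmaCompactSpace K := sigmaCompactSpace_of_locallyCompact_secondCountable
  have hnhds : (A : Set K) ∈ 𝓝 (0 : K) := by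
    have h := sub_mem_nhds_zero_of_addHaar_pos μ (A : Set K) hAcl.measurableSet hpos
    refine Filter.mem_of_superset h ?_
    rintro _ ⟨x, hx, y, hy, rfl⟩
    exact A.sub_mem hx hy
  have hall : ∀ y : K, y = u * σ y := by
    intro y
    have ht : Tendsto (fun k => ε k * y) atTop (𝓝 0) := by
      simpa only [zero_mul] using hε.mul_const y
    obtain ⟨k, hk⟩ := (ht.eventually_mem hnhds).exists
    have hk' : ε k * y = u * σ (ε k * y) := hk
    rw [map_mul, hσε, mul_left_comm] at hk'
    exact mul_left_cancel₀ (hε0 k) hk'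
  have hu : u = 1 := by
    have h1 := hall 1
    rw [map_one, mul_one] at h1
    exact h1.symm
  refine ha ?_
  have h2 := hall a
  rw [hu, one_mul] at h2
  exact h2.symm

include hσc in
/-- **An atomless finite measure on the norm-one torus `U(1) = {u | u·σ(u) = 1}`** (`σ` a continuous involution of the local field `K` moving some `a`,
with a `σ`-fixed null sequence of non-zero scalars): the push-forward of additive Haar measure on a compact neighbourhood under `x ↦ x∕σ(x)` is finite,
non-zero, gives measure `0` to every point (its fibres lie in the Haar-null twisted fixed lines `{x | x = u σ x}`), and is carried by `U(1)` (off `x = 0`,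
`(x∕σx)·σ(x∕σx) = 1` as `σ² = id`).  Hilbert 90 in measure form: `U(1) = {x∕σ(x)}`. [cite: Folland1995, §2.2] -/
theorem exists_atomless_measure_normOneTorus (hσσ : ∀ x, σ (σ x) = x) {a : K} (ha : σ a ≠ a)
    {ε : ℕ → K} (hε : Tendsto ε atTop (𝓝 0)) (hε0 : ∀ k, ε k ≠ 0) (hσε : ∀ k, σ (ε k) = ε k) :
    ∃ μ₁ : Measure K, IsFiniteMeasure μ₁ ∧ μ₁ ≠ 0 ∧ NullSingletonClass μ₁ ∧ μ₁ {u : K | u * σ u = 1}ᶜ = 0 := by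
  obtain ⟨B⟩ := (inferInstance : Nonempty (TopologicalSpace.PositiveCompacts K))
  set lam : Measure K := addHaar with hlam
  have hBfin : lam (B : Set K) < ⊤ := B.isCompact.measure_lt_top
  have hBpos : 0 < lam (B : Set K) := measure_pos_of_nonempty_interior lam B.interior_nonempty
  let f : K → K := fun x => x * (σ x)⁻¹
  have hf : Measurable f := measurable_id.mul hσc.measurable.inv
  haveI : IsFiniteMeasure (lam.restrict (B : Set K)) := isFiniteMeasure_restrict.mpr hBfin.ne
  have hnull := addHaar_setOf_eq_mul_map_eq_zero σ hσc lam ha hε hε0 hσε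
  refine ⟨(lam.restrict (B : Set K)).map f, inferInstance, fun h0 => ?_, ⟨fun u => ?_⟩, ?_⟩
  · -- non-zero: total mass `λ(B) > 0`
    have h1 : (lam.restrict (B : Set K)).map f univ = 0 := by rw [h0, Measure.coe_zero, Pi.zero_apply]
    rw [Measure.map_apply hf MeasurableSet.univ, preimage_univ, Measure.restrict_apply MeasurableSet.univ, univ_inter] at h1
    exact hBpos.ne' h1
  · -- atomless: the fibre over `u` lies in the null twisted fixed line
    rw [Measure.map_apply hf (measurableSet_singleton u)]
    refine le_antisymm ?_ zero_le
    calc lam.restrict (B : Set K) (f ⁻¹' {u}) ≤ lam (f ⁻¹' {u}) := Measure.restrict_apply_le _ _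
      _ ≤ lam {x : K | x = u * σ x} := by
          refine measure_mono fun x hx => ?_
          simp only [mem_preimage, mem_singleton_iff, f] at hx
          simp only [mem_setOf_eq]
          by_cases hσx : σ x = 0
          · have hx0 : x = 0 := σ.injective (by rw [hσx, map_zero])
            rw [hx0, map_zero, mul_zero]
          · rwa [mul_inv_eq_iff_eq_mul₀ hσx] at hx
      _ = 0 := hnull u
  · -- carried by `U(1)`: off `x = 0`, `f x ∈ U(1)`
    have hUm : MeasurableSet ({u : K | u * σ u = 1}ᶜ) :=
      (isClosed_eq (continuous_id.mul hσc) continuous_const).measurableSet.compl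
    rw [Measure.map_apply hf hUm]
    refine le_antisymm ?_ zero_le
    calc lam.restrict (B : Set K) (f ⁻¹' {u : K | u * σ u = 1}ᶜ) ≤ lam (f ⁻¹' {u : K | u * σ u = 1}ᶜ) := Measure.restrict_apply_le _ _
      _ ≤ lam {x : K | x = 0 * σ x} := by
          refine measure_mono fun x hx => ?_
          simp only [mem_preimage, mem_compl_iff, mem_setOf_eq, f] at hx
          simp only [mem_setOf_eq, zero_mul]
          by_contra hx0
          apply hx
          have hσx : σ x ≠ 0 := fun h => hx0 (σ.injective (by rw [h, map_zero]))
          rw [map_mul, map_inv₀, hσσ]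
          field_simp
      _ = 0 := hnull 0

end Torus

/-! ## §2 Unitary groups: closedness, the diagonal torus, and the diagonal-form case -/

section Unitary

variable {K : Type*} [Field K] [TopologicalSpace K] [IsTopologicalRing K]
  (σ : K →+* K) (hσc : Continuous σ)

include hσc in
/-- `U(σ, J) = {g | ᵗσ(g) J g = J}` is CLOSED in `GL_n(K)` (`σ` continuous). [cite: Folland1995, §2.2] -/
theorem isClosed_unitaryGroupOfForm [T2Space K] {n : Type*} [Fintype n] [DecidableEq n] (J : Matrix n n K) :
    IsClosed ((unitaryGroupOfForm σ J : Subgroup (GL n K)) : Set (GL n K)) := by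
  have hset : ((unitaryGroupOfForm σ J : Subgroup (GL n K)) : Set (GL n K)) =
      (fun g : GL n K => (((g : Matrix n n K)).map σ)ᵀ * J * (g : Matrix n n K)) ⁻¹' {J} := by
    ext g
    simp only [SetLike.mem_coe, mem_unitaryGroupOfForm_iff, mem_preimage, mem_singleton_iff]
  rw [hset]
  exact isClosed_singleton.preimage
    ((((Units.continuous_val.matrix_map hσc).matrix_transpose).mul continuous_const).mul Units.continuous_val)

omit [TopologicalSpace K] [IsTopologicalRing K] in
/-- **The diagonal torus**: a unit with matrix `diag(t)`, `t_i σ(t_i) = 1`, lies in `U(σ, diag h)` (`ᵗσ(diag t)·diag h·diag t = diag(σ(t) h t) = diag h`).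
[cite: Rogawski1990, §12.5 p. 182] -/
theorem mem_unitaryGroupOfForm_diagonal_of_coe_eq (h : Fin 3 → K) {t : Fin 3 → K} (ht : ∀ i, t i * σ (t i) = 1) (D : GL (Fin 3) K)
    (hD : (D : Matrix (Fin 3) (Fin 3) K) = Matrix.diagonal t) : D ∈ unitaryGroupOfForm σ (Matrix.diagonal h) := by
  rw [mem_unitaryGroupOfForm_iff, hD, Matrix.diagonal_map (map_zero σ), Matrix.diagonal_transpose, Matrix.diagonal_mul_diagonal,
    Matrix.diagonal_mul_diagonal]
  congr 1
  funext i
  rw [mul_assoc, mul_comm (h i), ← mul_assoc, mul_comm (σ (t i)), ht i, one_mul]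

variable [ContinuousInv₀ K] [T2Space K] [LocallyCompactSpace K] [SecondCountableTopology K] [MeasurableSpace K] [BorelSpace K] [CharZero K]

include hσc in
/-- **The diagonal-form case.**  `σ` a continuous involution of the characteristic-`0` local field `K` moving some `a`, `ε_k → 0` non-zero `σ`-fixed; `h ∈ K³`.
There is a CLOSED subset `S` of `U(σ, diag h)` containing every element whose characteristic polynomial is not separable and NULL for every Haar measure.
(`S = {D(entries) = 0}` for the discriminant polynomial `D` of ★ `exists_mvPolynomial_discr_charpoly_fin_three`; shear along the diagonal torus `diag(u)`,
`u ∈ U(1)³`, with the atomless parameter measure of §1; every fibre is the zero set of a non-zero polynomial in `u`.) [cite: HarishChandra1970, Lemma 42]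
[cite: Rogawski1990, §12.5 p. 182] -/
theorem exists_closed_null_superset_singular_diagonal (hσσ : ∀ x, σ (σ x) = x) {a : K} (ha : σ a ≠ a)
    {ε : ℕ → K} (hε : Tendsto ε atTop (𝓝 0)) (hε0 : ∀ k, ε k ≠ 0) (hσε : ∀ k, σ (ε k) = ε k) (h : Fin 3 → K)
    [MeasurableSpace ↥(unitaryGroupOfForm σ (Matrix.diagonal h))] [BorelSpace ↥(unitaryGroupOfForm σ (Matrix.diagonal h))] :
    ∃ S : Set ↥(unitaryGroupOfForm σ (Matrix.diagonal h)), IsClosed S ∧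
      (∀ u : ↥(unitaryGroupOfForm σ (Matrix.diagonal h)), ¬ ((u : GL (Fin 3) K) : Matrix (Fin 3) (Fin 3) K).charpoly.Separable → u ∈ S) ∧
      ∀ ν : Measure ↥(unitaryGroupOfForm σ (Matrix.diagonal h)), ν.IsHaarMeasure → ν S = 0 := by
  classical
  obtain ⟨Dp, hDa, hDb⟩ := exists_mvPolynomial_discr_charpoly_fin_three K
  -- topology of `G`
  haveI : SecondCountableTopology (Matrix (Fin 3) (Fin 3) K) := inferInstanceAs (SecondCountableTopology (Fin 3 → Fin 3 → K))
  haveI : SecondCountableTopology (Matrix (Fin 3) (Fin 3) K)ᵐᵒᵖ := MulOpposite.opHomeomorph.symm.secondCountableTopology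
  haveI : SecondCountableTopology (GL (Fin 3) K) := Units.isEmbedding_embedProduct.secondCountableTopology
  haveI : SecondCountableTopology ↥(unitaryGroupOfForm σ (Matrix.diagonal h)) := TopologicalSpace.Subtype.secondCountableTopology _
  haveI : LocallyCompactSpace (Matrix (Fin 3) (Fin 3) K) := inferInstanceAs (LocallyCompactSpace (Fin 3 → Fin 3 → K))
  haveI : LocallyCompactSpace (GL (Fin 3) K) := inferInstance
  haveI : LocallyCompactSpace ↥(unitaryGroupOfForm σ (Matrix.diagonal h)) := (isClosed_unitaryGroupOfForm σ hσc (Matrix.diagonal h)).isClosedEmbedding_subtypeVal.locallyCompactSpace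
  -- the closed superset `S = {Φ = 0}`
  let Φ : ↥(unitaryGroupOfForm σ (Matrix.diagonal h)) → K := fun u => MvPolynomial.eval (fun ij : Fin 3 × Fin 3 => ((u : GL (Fin 3) K) : Matrix (Fin 3) (Fin 3) K) ij.1 ij.2) Dp
  have hΦc : Continuous Φ :=
    (MvPolynomial.continuous_eval Dp).comp
      (continuous_pi fun ij : Fin 3 × Fin 3 => (Units.continuous_val.comp continuous_subtype_val).matrix_elem ij.1 ij.2)
  have hSm : MeasurableSet (Φ ⁻¹' {0}) := (isClosed_singleton.preimage hΦc).measurableSet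
  refine ⟨Φ ⁻¹' {0}, isClosed_singleton.preimage hΦc, fun u hu => ?_, fun ν hν => ?_⟩
  · by_contra hne
    exact hu (hDa _ hne)
  -- the parameter measure `μ = μ₁^{⊗3}`
  obtain ⟨μ₁, hfin, hne, hatom, hconc⟩ := exists_atomless_measure_normOneTorus σ hσc hσσ ha hε hε0 hσε
  haveI := hfin
  haveI := hatom
  set μ : Measure (Fin 3 → K) := Measure.pi (fun _ : Fin 3 => μ₁) with hμ
  have hμ0 : μ ≠ 0 := by
    intro h0
    have h1 : μ univ = 0 := by rw [h0, Measure.coe_zero, Pi.zero_apply]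
    rw [hμ, Measure.pi_univ, Finset.prod_const] at h1
    exact pow_ne_zero _ (Measure.measure_univ_ne_zero.mpr hne) h1
  -- the diagonal torus `ι`
  set C : Set (Fin 3 → K) := {t | ∀ i, t i * σ (t i) = 1} with hC
  have hCcl : IsClosed C := by
    have hC' : C = ⋂ i, {t : Fin 3 → K | t i * σ (t i) = 1} := by
      ext t
      simp only [hC, mem_setOf_eq, mem_iInter]
    rw [hC']
    exact isClosed_iInter fun i => isClosed_eq ((continuous_apply i).mul (hσc.comp (continuous_apply i))) continuous_const
  have hCne : ∀ t ∈ C, ∀ i, t i ≠ 0 := fun t ht i h0 => by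
    have h1 := ht i
    rw [h0, zero_mul] at h1
    exact zero_ne_one h1
  have hdet : ∀ t ∈ C, (Matrix.diagonal t).det ≠ 0 := fun t ht => by
    rw [Matrix.det_diagonal]
    exact Finset.prod_ne_zero_iff.mpr fun i _ => hCne t ht i
  have hmem : ∀ t (ht : t ∈ C), Matrix.GeneralLinearGroup.mkOfDetNeZero (Matrix.diagonal t) (hdet t ht) ∈ unitaryGroupOfForm σ (Matrix.diagonal h) := fun t ht =>
    mem_unitaryGroupOfForm_diagonal_of_coe_eq σ h ht _ rfl
  let ι₀ : ↥C → ↥(unitaryGroupOfForm σ (Matrix.diagonal h)) := fun t => ⟨Matrix.GeneralLinearGroup.mkOfDetNeZero (Matrix.diagonal t.1) (hdet t.1 t.2), hmem t.1 t.2⟩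
  have hι₀c : Continuous ι₀ := by
    refine Continuous.subtype_mk ?_ _
    rw [Units.continuous_iff]
    refine ⟨?_, ?_⟩
    · have h1 : (Units.val ∘ fun t : ↥C => Matrix.GeneralLinearGroup.mkOfDetNeZero (Matrix.diagonal t.1) (hdet t.1 t.2)) =
          fun t : ↥C => Matrix.diagonal t.1 := rfl
      rw [h1]
      exact continuous_subtype_val.matrix_diagonal
    · have h2 : (fun t : ↥C => (((Matrix.GeneralLinearGroup.mkOfDetNeZero (Matrix.diagonal t.1) (hdet t.1 t.2))⁻¹ : GL (Fin 3) K) :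
            Matrix (Fin 3) (Fin 3) K)) = fun t : ↥C => Matrix.diagonal fun i => (t.1 i)⁻¹ := by
        funext t
        rw [Matrix.coe_units_inv]
        refine Matrix.inv_eq_left_inv ?_
        show (Matrix.diagonal fun i => (t.1 i)⁻¹) * Matrix.diagonal t.1 = 1
        rw [Matrix.diagonal_mul_diagonal, ← Matrix.diagonal_one]
        congr 1
        funext i
        exact inv_mul_cancel₀ (hCne t.1 t.2 i)
      rw [h2]
      exact (continuous_pi fun i => ((continuous_apply i).comp continuous_subtype_val).inv₀ fun t => hCne t.1 t.2 i).matrix_diagonal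
  set ι : (Fin 3 → K) → ↥(unitaryGroupOfForm σ (Matrix.diagonal h)) := fun t => if ht : t ∈ C then ι₀ ⟨t, ht⟩ else 1 with hι
  have hιm : Measurable ι := Measurable.dite hι₀c.measurable measurable_const hCcl.measurableSet
  -- σ-finiteness of the Haar measure `ν`
  haveI : SigmaCompactSpace ↥(unitaryGroupOfForm σ (Matrix.diagonal h)) := sigmaCompactSpace_of_locallyCompact_secondCountable
  haveI : SigmaFinite ν := inferInstance
  refine measure_eq_zero_of_forall_shear_null ν μ hμ0 hιm hSm fun g => ?_
  -- the fibre over `g`: inside `Cᶜ ∪ {t | R_g(t) = 0}` with `R_g ≠ 0`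
  set gm : Matrix (Fin 3) (Fin 3) K := ((g : GL (Fin 3) K) : Matrix (Fin 3) (Fin 3) K) with hgm
  have hgdet : gm.det ≠ 0 := Matrix.GeneralLinearGroup.det_ne_zero _
  obtain ⟨t₀, ht₀⟩ := hDb gm hgdet
  set R : MvPolynomial (Fin 3) K :=
    MvPolynomial.bind₁ (fun ij : Fin 3 × Fin 3 => MvPolynomial.X ij.1 * MvPolynomial.C (gm ij.1 ij.2)) Dp with hR
  have hRev : ∀ t : Fin 3 → K,
      MvPolynomial.eval t R = MvPolynomial.eval (fun ij : Fin 3 × Fin 3 => (Matrix.diagonal t * gm) ij.1 ij.2) Dp := by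
    intro t
    have h1 : MvPolynomial.eval t R =
        MvPolynomial.eval (fun ij : Fin 3 × Fin 3 => MvPolynomial.eval t (MvPolynomial.X ij.1 * MvPolynomial.C (gm ij.1 ij.2))) Dp := by
      rw [hR]
      exact MvPolynomial.eval₂Hom_bind₁ _ _ _ _
    have h2 : (fun ij : Fin 3 × Fin 3 => MvPolynomial.eval t (MvPolynomial.X ij.1 * MvPolynomial.C (gm ij.1 ij.2))) =
        fun ij : Fin 3 × Fin 3 => (Matrix.diagonal t * gm) ij.1 ij.2 := by
      funext ij
      rw [map_mul, MvPolynomial.eval_X, MvPolynomial.eval_C, Matrix.diagonal_mul]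
    rw [h1, h2]
  have hR0 : R ≠ 0 := fun h0 => ht₀ (by rw [← hRev, h0, map_zero])
  have hnull : μ {t : Fin 3 → K | MvPolynomial.eval t R = 0} = 0 := by
    have h1 := pi_zeroLocus_mvPolynomial_eq_zero (K := K) (X := K) (e := id) measurable_id injective_id μ₁ 3 R hR0
    simpa only [id] using h1
  have hCc : μ Cᶜ = 0 := by
    have hsub : Cᶜ ⊆ ⋃ i : Fin 3, Function.eval i ⁻¹' {u : K | u * σ u = 1}ᶜ := by
      intro t ht
      simp only [hC, mem_compl_iff, mem_setOf_eq, not_forall] at ht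
      obtain ⟨i, hi⟩ := ht
      exact mem_iUnion.2 ⟨i, hi⟩
    exact measure_mono_null hsub (measure_iUnion_null fun i => Measure.pi_eval_preimage_null (fun _ : Fin 3 => μ₁) hconc)
  refine measure_mono_null (fun t ht => ?_) (measure_union_null hCc hnull)
  by_cases htC : t ∈ C
  · refine Or.inr ?_
    simp only [mem_setOf_eq] at ht ⊢
    rw [hRev]
    have hval : (((ι t * g : ↥(unitaryGroupOfForm σ (Matrix.diagonal h))) : GL (Fin 3) K) : Matrix (Fin 3) (Fin 3) K) = Matrix.diagonal t * gm := by
      rw [Subgroup.coe_mul, Units.val_mul, hgm, hι]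
      simp only [dif_pos htC]
      rfl
    have ht' : Φ (ι t * g) = 0 := ht
    simpa only [Φ, hval] using ht'
  · exact Or.inl htC

/-! ## §3 General forms congruent to a diagonal one -/

include hσc in
/-- **A CLOSED, HAAR-NULL SUPERSET OF THE SINGULAR LOCUS OF `U(σ, J)`** for `J` congruent over `K` to a diagonal form, `formCongr σ T J = ᵗσ(T)·J·T = diag h`
(`σ` a continuous involution of the characteristic-`0` local field `K` with `σ a ≠ a`, `ε_k → 0` non-zero `σ`-fixed): transport of the diagonal case along
`g ↦ T g T⁻¹ : U(σ, diag h) ≃ₜ* U(σ, J)` (★ `unitaryGroupOfFormCongrOfEq`; characteristic polynomials and Haar measures are preserved).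
[cite: HarishChandra1970, Lemma 42] [cite: Rogawski1990, §12.5 p. 182] -/
theorem exists_closed_null_superset_singular (hσσ : ∀ x, σ (σ x) = x) {a : K} (ha : σ a ≠ a)
    {ε : ℕ → K} (hε : Tendsto ε atTop (𝓝 0)) (hε0 : ∀ k, ε k ≠ 0) (hσε : ∀ k, σ (ε k) = ε k)
    {J : Matrix (Fin 3) (Fin 3) K} {T : GL (Fin 3) K} {h : Fin 3 → K} (hT : formCongr σ T J = Matrix.diagonal h)
    [MeasurableSpace ↥(unitaryGroupOfForm σ J)] [BorelSpace ↥(unitaryGroupOfForm σ J)] :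
    ∃ S : Set ↥(unitaryGroupOfForm σ J), IsClosed S ∧
      (∀ u : ↥(unitaryGroupOfForm σ J), ¬ ((u : GL (Fin 3) K) : Matrix (Fin 3) (Fin 3) K).charpoly.Separable → u ∈ S) ∧
      ∀ ν : Measure ↥(unitaryGroupOfForm σ J), ν.IsHaarMeasure → ν S = 0 := by
  letI : MeasurableSpace ↥(unitaryGroupOfForm σ (Matrix.diagonal h)) := borel _
  haveI : BorelSpace ↥(unitaryGroupOfForm σ (Matrix.diagonal h)) := ⟨rfl⟩
  obtain ⟨S₀, hS₀c, hS₀sing, hS₀null⟩ := exists_closed_null_superset_singular_diagonal σ hσc hσσ ha hε hε0 hσε h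
  -- `e : U(σ, diag h) ≃ₜ* U(σ, J)`, `g ↦ T g T⁻¹`
  set e := unitaryGroupOfFormCongrOfEq σ T J (Matrix.diagonal h) hT with he
  refine ⟨e.symm ⁻¹' S₀, hS₀c.preimage e.symm.continuous, fun u hu => ?_, fun ν hν => ?_⟩
  · -- `T⁻¹ u T` is singular with `u`
    refine hS₀sing (e.symm u) fun hsep => hu ?_
    have hcoe : (((e.symm u : ↥(unitaryGroupOfForm σ (Matrix.diagonal h))) : GL (Fin 3) K) : Matrix (Fin 3) (Fin 3) K) =
        ((T⁻¹ : GL (Fin 3) K) : Matrix (Fin 3) (Fin 3) K) * ((u : GL (Fin 3) K) : Matrix (Fin 3) (Fin 3) K) * (T : Matrix (Fin 3) (Fin 3) K) := by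
      rw [he, coe_unitaryGroupOfFormCongrOfEq_symm_apply, Units.val_mul, Units.val_mul]
    rw [hcoe, Matrix.coe_units_inv, Matrix.charpoly_units_conj'] at hsep
    exact hsep
  · haveI : (ν.map e.symm).IsHaarMeasure := ContinuousMulEquiv.isHaarMeasure_map ν e.symm
    have h1 := hS₀null (ν.map e.symm) inferInstance
    have hm : Measurable (e.symm : ↥(unitaryGroupOfForm σ J) → ↥(unitaryGroupOfForm σ (Matrix.diagonal h))) :=
      e.symm.continuous.measurable
    rwa [Measure.map_apply hm hS₀c.measurableSet] at h1

include hσc in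
/-- **THE SINGULAR SET OF `U(σ, J)` IS HAAR-NULL** (`J ∈ M₃(K)` congruent over `K` to a diagonal form; `σ` a continuous involution of the characteristic-`0`
local field `K` moving some element, with a `σ`-fixed null sequence of non-zero scalars): for every Haar measure `ν` on `U(σ, J)`, the elements whose
characteristic polynomial is not separable form a `ν`-null set.  «The complement of the regular set has measure zero» — the measure theory behind the Weyl
integration formula. [cite: HarishChandra1970, Lemma 42] [cite: Rogawski1990, §12.5 p. 182] -/
theorem measure_setOf_not_separable_charpoly_eq_zero (hσσ : ∀ x, σ (σ x) = x) {a : K} (ha : σ a ≠ a)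
    {ε : ℕ → K} (hε : Tendsto ε atTop (𝓝 0)) (hε0 : ∀ k, ε k ≠ 0) (hσε : ∀ k, σ (ε k) = ε k)
    {J : Matrix (Fin 3) (Fin 3) K} {T : GL (Fin 3) K} {h : Fin 3 → K} (hT : formCongr σ T J = Matrix.diagonal h)
    [MeasurableSpace ↥(unitaryGroupOfForm σ J)] [BorelSpace ↥(unitaryGroupOfForm σ J)]
    (ν : Measure ↥(unitaryGroupOfForm σ J)) [ν.IsHaarMeasure] :
    ν {u : ↥(unitaryGroupOfForm σ J) | ¬ ((u : GL (Fin 3) K) : Matrix (Fin 3) (Fin 3) K).charpoly.Separable} = 0 := by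
  obtain ⟨S, -, hSsing, hSnull⟩ := exists_closed_null_superset_singular σ hσc hσσ ha hε hε0 hσε hT
  exact measure_mono_null (fun u hu => hSsing u hu) (hSnull ν inferInstance)

end Unitary

end Literature.LinearAlgebra.Matrix

end
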